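import Mathlib.MeasureTheory.Integral.IntervalIntegral.Basic
import Mathlib.Analysis.SpecialFunctions.Pow.Real
import Mathlib.Order.Filter.AtTopBot.Basic
import Literature.Analysis.FunctionSpaces.FlatTorus
import Literature.Analysis.FunctionSpaces.TorusCalculus
import Literature.Analysis.FunctionSpaces.TorusFluidGlue
import Literature.Analysis.FluidPDE.AnomalousDissipationWholeSpace
import HarnessLib

/-!
# Enhanced dissipation by quasi-streamwise vortices in `2½`-dimensional Navier–Stokes flows
  (Jeong–Yoneda, Proc. AMS 150 (2022), Thm. 1.1)

Topic `Analysis/FluidPDE`; the `T³` companion of `AnomalousDissipationWholeSpace.lean` (Li–Yu–Zhu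
2025: `ℝ^d`, `ν`-dependent data, pure heat mechanism) and one of the two `2½`-dimensional precedents
that Bruè–De Lellis 2023 name for their construction (`AnomalousDissipationTwoHalfD.lean`, §3 p. 7:
"This framework has already been considered in the study of anomalous dissipation by Jeong and Yoneda
in [JY21, JY22]"). Vocabulary `FunctionSpaces.Torus.IsClassicalNSSolutionOn`,
`FunctionSpaces.Torus.cumulativeDissipation`, `FunctionSpaces.Torus.IsSmooth`, `IsSmoothSpaceTimeOn`,
`timeDerivWithin`, `laplacian` (`TorusFluidGlue.lean`, `TorusCalculus.lean`) and the viscosity sequence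
`LiYuZhu2025.visc n = 2^{-2n}` (`AnomalousDissipationWholeSpace.lean`, the SAME sequence) reused, never
redeclared.

I.-J. Jeong, T. Yoneda, *Quasi-streamwise vortices and enhanced dissipation for incompressible 3D
Navier–Stokes equations*, Proc. Amer. Math. Soc. 150 (2022), no. 3, 1279–1286,
doi:10.1090/proc/15754 = arXiv:2012.14621 (held as `paper:arxiv-2012.14621`, TeX-source render in 7
chunks; statements checked on that render 2026-08-27: §1 with (NS), the energy balance, the heat flow
(heat), **Theorem 1.1** with its two displays [enhanced dissipation; heat comparison],
Remarks 1.2–1.3; §2 proof: the `2½`-D ansatz `u = u^L(t,x₂) e₁ + u^S(t,x₁,x₂) e₃`, §2.1 `u^L₀(x₂) =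
T(ν^{-1/2}x₂)` (smoothed triangular wave, heat flow), §2.2 `u^S₀ = sin(ν^{-α}x₁) φ(ν^{-1/2}x₂)` and the
ODE for `a(t)`, Remark 2.3 (loss of energy on the `O(ν^{2α/3})` time scale iff `α < 3/4`), §2.3–2.4).
The two displays of Theorem 1.1 are referred to below as (ED) [enhanced dissipation] and (HE) [heat
comparison] (the render carries the LaTeX labels `enhanced-dissipation` / `heat-equation`; their printed
numbers were not checked on a paginated copy, hence no display numbers are quoted).

## Contents

* `JeongYoneda2022_thm11` — **Theorem 1.1** (named fact).

## Rendering and faithfulness notes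

* `T³ = UnitAddTorus (Fin 3)` with its probability Haar measure, so `‖u₀‖_{L²} = 1` is `∫ ‖u₀‖² = 1`.
* "the solution `u^{ν_n}` to the 3D incompressible Navier–Stokes equations (NS) with zero external force":
  a global classical solution `IsClassicalNSSolutionOn (Ici 0) ν_n 0 (u n) (p n)` with `u n 0 = u₀ n` — for
  the source's `2½`-dimensional data the solution is the explicit globally smooth shear–transport pair of
  §2 (heat flow for `u^L`, linear advection–diffusion for `u^S`), so asserting its existence inside the `∃`
  adds nothing beyond print.
* (ED) `liminf_n ν_n ∫₀^{ν_n^{2α/3}} ‖∇u^{ν_n}(t)‖²_{L²} dt ≥ c`, "for some absolute constant `c > 0`", is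
  typed in the equivalent eventually-form `∃ c > 0, ∀ᶠ n, c ≤ ν_n ∫₀^{ν_n^{2α/3}} ‖∇u^{ν_n}‖²` (for an
  existential positive constant the two are interchangeable), with the tree's
  `cumulativeDissipation ν u 0 b = ν ∫₀ᵇ ‖∇u(t)‖²_{L²} dt` (derivative-based, interval integral).
* (HE) concerns "the unique `L²` solution" of the heat equation `∂ₜu = νΔu`, `u(0) = u₀^{ν_n}` on
  `ℝ₊ × T³`: rendered by a jointly smooth `h n` on `[0,∞) × T³` solving the heat equation pointwise
  (one-sided time derivative `timeDerivWithin (Ici 0)`, the convention of `IsClassicalNSSolutionOn`) from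
  the same datum — for smooth data this is that unique solution — with the bound for every `n ≥ 1` and an
  existential absolute constant `C > 0`, exponent `1 - 2 max{1/2, α}` verbatim.
* `ν_n = 2^{-2n}`, data indexed by `n ≥ 1`, smooth; the source's standing integrality conventions
  ("`ν^{-1/2}` is an integer", "`ν^{-α}` is an integer (otherwise … its integer part)", §2.1–2.2) are
  proof devices, not hypotheses of Theorem 1.1.
* Viscosity-DEPENDENT data, zero force, finite (shrinking) window: like `LiYuZhu2025_thm1` this has no
  bearing on the `ν`-independent steady force of `Literature.Turb.ZerothLaw` / `BrueDeLellisQuestion21`;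
  unlike Li–Yu–Zhu the mechanism is NOT the heat flow ((HE) and the sentence after Theorem 1.1:
  "viscosity alone is not enough to obtain such an enhanced dissipation") but vortex stretching of the
  vertical component by the shear.

## References

* I.-J. Jeong, T. Yoneda, Proc. Amer. Math. Soc. 150 (2022) 1279–1286, Thm. 1.1. [`JeongYoneda2022`]
* I.-J. Jeong, T. Yoneda, Math. Ann. 380 (2021) 2041–2072 (the companion [JY] of Remark 1.2). [`JeongYoneda2020`]
* E. Bruè, C. De Lellis, Comm. Math. Phys. 400 (2023), §3 p. 7. [`BrueDeLellisCMP2023`]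
-/

open MeasureTheory Set Filter
open scoped NNReal ENNReal Topology

noncomputable section

namespace Literature.Analysis.FluidPDE

section JeongYoneda

/-- **Jeong–Yoneda 2022, Theorem 1.1** (Proc. AMS 150 (2022) 1279–1286, §1; arXiv:2012.14621), verbatim:
"For any `α ∈ (0,3/4)`, there is a sequence of smooth initial data `{u₀^{ν_n}}_{n≥1}` on `T³` with
`ν_n = 2^{-2n}` and `‖u₀^{ν_n}‖_{L²} = 1` such that, for the solution `u^{ν_n}` to the 3D incompressible
Navier–Stokes equations (NS) with zero external force, we have
`liminf_{n→∞} ν_n ∫₀^{ν_n^{2α/3}} ‖∇u^{ν_n}(t)‖²_{L²} dt ≥ c` [(ED)] for some absolute constant `c > 0`,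
whereas for the solution to the heat equation (heat), we have
`ν_n ∫₀^{ν_n^{2α/3}} ‖∇u^{ν_n,heat}(t)‖²_{L²} dt ≤ C ν_n^{2α/3} (1 + ν_n^{1-2max{1/2,α}})`, [(HE)] with some
absolute constant `C > 0`, so that the right hand side vanishes as `n → ∞`." Rendering (module
docstring): `ν_n = LiYuZhu2025.visc n = 2^{-2n}`; smooth data of unit `L²` norm on the probability space
`T³`; global classical unforced Navier–Stokes solutions `IsClassicalNSSolutionOn (Ici 0) ν_n 0 (u n) (p n)`
with `u n 0 = u₀ n`; (ED) in the eventually-form with `cumulativeDissipation`; (HE) for the smooth heat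
flow `h n` from the same datum. Viscosity-dependent data: no bearing on `Literature.Turb.ZerothLaw`.
[cite: JeongYoneda2022, Thm. 1.1] -/
def JeongYoneda2022_thm11 : Prop :=
  ∀ α : ℝ, 0 < α → α < 3 / 4 →
    ∃ (u₀ : ℕ → UnitAddTorus (Fin 3) → EuclideanSpace ℝ (Fin 3))
      (u : ℕ → ℝ → UnitAddTorus (Fin 3) → EuclideanSpace ℝ (Fin 3))
      (p : ℕ → ℝ → UnitAddTorus (Fin 3) → ℝ)
      (h : ℕ → ℝ → UnitAddTorus (Fin 3) → EuclideanSpace ℝ (Fin 3)),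
      -- smooth data of unit `L²` norm, `n ≥ 1`
      (∀ n, 1 ≤ n → FunctionSpaces.Torus.IsSmooth (u₀ n) ∧ ∫ x, ‖u₀ n x‖ ^ 2 = 1) ∧
      -- `u^{ν_n}`: the (global, classical) unforced Navier–Stokes solution with viscosity `ν_n` from `u₀^{ν_n}`
      (∀ n, 1 ≤ n →
        FunctionSpaces.Torus.IsClassicalNSSolutionOn (Ici (0 : ℝ)) (LiYuZhu2025.visc n) 0 (u n) (p n) ∧
          u n 0 = u₀ n) ∧
      -- `u^{ν_n,heat}`: the heat flow `∂ₜh = ν_n Δh`, `h(0) = u₀^{ν_n}`, smooth on `[0,∞) × T³`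
      (∀ n, 1 ≤ n →
        FunctionSpaces.Torus.IsSmoothSpaceTimeOn (Ici (0 : ℝ)) (h n) ∧
          (∀ t ∈ Ici (0 : ℝ), ∀ x,
            FunctionSpaces.Torus.timeDerivWithin (Ici (0 : ℝ)) (h n) t x =
              LiYuZhu2025.visc n • FunctionSpaces.Torus.laplacian (h n t) x) ∧
          h n 0 = u₀ n) ∧
      -- (ED): `liminf_n ν_n ∫₀^{ν_n^{2α/3}} ‖∇u^{ν_n}(t)‖²_{L²} dt ≥ c > 0`
      (∃ c : ℝ, 0 < c ∧ ∀ᶠ n in atTop,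
        c ≤ FunctionSpaces.Torus.cumulativeDissipation (LiYuZhu2025.visc n) (u n) 0
          ((LiYuZhu2025.visc n) ^ (2 * α / 3))) ∧
      -- (HE): `ν_n ∫₀^{ν_n^{2α/3}} ‖∇u^{ν_n,heat}(t)‖²_{L²} dt ≤ C ν_n^{2α/3} (1 + ν_n^{1 - 2 max{1/2, α}})`
      ∃ C : ℝ, 0 < C ∧ ∀ n, 1 ≤ n →
        FunctionSpaces.Torus.cumulativeDissipation (LiYuZhu2025.visc n) (h n) 0
            ((LiYuZhu2025.visc n) ^ (2 * α / 3)) ≤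
          C * (LiYuZhu2025.visc n) ^ (2 * α / 3) * (1 + (LiYuZhu2025.visc n) ^ (1 - 2 * max (1 / 2 : ℝ) α))

/-- The right-hand side of (HE) tends to `0`: `C ν_n^{2α/3} (1 + ν_n^{1-2max{1/2,α}}) → 0` as `n → ∞`
for `0 < α < 3/4` ("so that the right hand side vanishes as `n → ∞`", Thm. 1.1) — since `ν_n → 0⁺`,
`2α/3 > 0` and `2α/3 + 1 - 2max{1/2,α} = min{2α/3, 1 - 4α/3} > 0` on `(0, 3/4)`.
[cite: JeongYoneda2022, Thm. 1.1 (its last clause)] -/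
theorem JeongYoneda2022.tendsto_heatBound_zero {α : ℝ} (hα : 0 < α) (hα' : α < 3 / 4) (C : ℝ) :
    Tendsto (fun n : ℕ => C * (LiYuZhu2025.visc n) ^ (2 * α / 3) *
      (1 + (LiYuZhu2025.visc n) ^ (1 - 2 * max (1 / 2 : ℝ) α))) atTop (𝓝 0) := by
  -- `ν_n = 4^{-n} → 0`, `ν_n > 0`
  have hν : Tendsto (fun n : ℕ => LiYuZhu2025.visc n) atTop (𝓝 0) := by
    unfold LiYuZhu2025.visc
    exact tendsto_pow_atTop_nhds_zero_of_lt_one (by norm_num) (by norm_num)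
  have hνpos : ∀ n, 0 < LiYuZhu2025.visc n := LiYuZhu2025.visc_pos
  -- split `ν^{2α/3} (1 + ν^{e}) = ν^{2α/3} + ν^{2α/3 + e}` with both exponents positive
  have he1 : 0 < 2 * α / 3 := by positivity
  have he2 : 0 < 2 * α / 3 + (1 - 2 * max (1 / 2 : ℝ) α) := by
    rcases le_or_gt α (1 / 2) with h | h
    · rw [max_eq_left h]; linarith
    · rw [max_eq_right h.le]; linarith
  have h1 : Tendsto (fun n : ℕ => (LiYuZhu2025.visc n) ^ (2 * α / 3)) atTop (𝓝 0) := by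
    have := hν.rpow_const (p := 2 * α / 3) (Or.inr he1.le)
    rw [Real.zero_rpow he1.ne'] at this
    exact this
  have h2 : Tendsto (fun n : ℕ => (LiYuZhu2025.visc n) ^ (2 * α / 3 + (1 - 2 * max (1 / 2 : ℝ) α)))
      atTop (𝓝 0) := by
    have := hν.rpow_const (p := 2 * α / 3 + (1 - 2 * max (1 / 2 : ℝ) α)) (Or.inr he2.le)
    rw [Real.zero_rpow he2.ne'] at this
    exact this
  have heq : (fun n : ℕ => C * (LiYuZhu2025.visc n) ^ (2 * α / 3) *
      (1 + (LiYuZhu2025.visc n) ^ (1 - 2 * max (1 / 2 : ℝ) α))) =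
      fun n => C * ((LiYuZhu2025.visc n) ^ (2 * α / 3) +
        (LiYuZhu2025.visc n) ^ (2 * α / 3 + (1 - 2 * max (1 / 2 : ℝ) α))) := by
    funext n
    rw [Real.rpow_add (hνpos n)]
    ring
  rw [heq]
  simpa using (h1.add h2).const_mul C

end JeongYoneda

end Literature.Analysis.FluidPDE

end
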